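import Literature.NumberTheory.ComplexMultiplication.KottwitzSignatureReflexFieldDegree
import HarnessLib

/-!
# Conjugates over a subfield `M ⊂ ℂ`: an object with field of definition `N` has exactly `[M·N : M]` conjugates under
# `Aut(ℂ/M)` — CM types over `φ₀(F)` (`[E : φ₀(F)]`), the distinguished element over `E_Φ` (`[E : E_Φ]`), signatures over `M`

Layer `Literature/NumberTheory/ComplexMultiplication`, namespace `Literature.NumberTheory.ComplexMultiplication` (lane
`lit-hodgefound`, Track 2 foundations, Layer A3; seat `lit-hodgefound-p11`, generation 29, row g29-#10).  Sequel of
`KottwitzSignatureReflexFieldDegree` (g29-#5: the ABSOLUTE count `natCard_range_eq_finrank_of_forall_iff` — objects `x τ`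
with `x τ = x τ′ ⟺ τ|_N = τ′|_N` number `[N : ℚ]`) and `CMTypeGaloisClassSignatureBlocks` (g29-#8: the conjugates of `Φ` over
`ℚ(tr_Φ(k₀)) ⊆ K*` number `[K* : ℚ(tr_Φ(k₀))]`).  THIS file proves the RELATIVE count over an ARBITRARY number field `M ⊂ ℂ`
and reads it on the objects of this lineage.  THEOREMS ONLY (D-0026): no definition, no named fact, no instance; the
`Aut(ℂ/M)`-orbit is WRITTEN OUT as `{y // ∃ τ, (∀ z ∈ M, τ z = z) ∧ y = x τ}` and `[M·N : M]` as Mathlib's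
`IntermediateField.relfinrank M (M ⊔ N)` (`= [M ⊔ N : M ⊓ (M ⊔ N)] = [M ⊔ N : M]`).

THE PRINTS.  J. S. Milne, *Fields and Galois Theory* (v5.10, 2022) [MilneFT2022] Prop. 2.7 («the number of `F`-homomorphisms
`E → Ω` is `[E : F]`» for `Ω` algebraically closed ⊇ separable `E/F`), Cor. 3.4 / Thm. 3.16 (Galois correspondence: conjugates ↔
cosets), Prop. 1.20 (tower law); S. Lang, *Algebra* [Lang2002] Ch. VIII §1 (every embedding of a subfield of `ℂ` of countable
transcendence data extends to an automorphism of `ℂ`; the tree's `ZarhinLie.exists_ringEquiv_complex_comp_eq`).  Read for CM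
types: G. Shimura [Shimura1998] §8.3 Prop. 28 (`[K* : ℚ] = [G : H*]`; relative form `[H_M : H_M ∩ H*]`), B. Dodson [Dodson1984]
§1.1 Remark (p. 5: «`[K′ : ℚ]` is also the order of the orbit of `Φ`»); for the Rapoport–Smithling–Zhang datum `(F, Φ, φ₀)`
[RapoportSmithlingZhang2017] §3.1 eq. (3.1) and the sentence after it («`E` contains `F` via `φ₀` … possibly a proper
extension when `F/ℚ` is not Galois»): the number of conjugates of `Φ` over `φ₀(F)` is `[E : φ₀(F)]`, and of `φ₀` over `E_Φ`
is `[E : E_Φ]`.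

WHAT IS PROVED (`x : Aut(ℂ) → X` with `x τ = x τ′ ⟺ τ|_N = τ′|_N`; `M`, `N ⊂ ℂ` number fields).
§1 **`natCard_range_fixing_eq_relfinrank`** (`#{x τ ∣ τ ∈ Aut(ℂ/M)} = [M·N : M]`: the orbit ↔ the `M`-embeddings `M·N → ℂ`,
   counted by `AlgHom.card` over `M`, each extended to `Aut(ℂ/M)`), `natCard_range_fixing_mul_finrank` (`· [M : ℚ] = [M·N : ℚ]`),
   `natCard_range_fixing_eq_relfinrank_of_le` (`M ≤ N`: `= [N : M]`), `natCard_range_fixing_eq_one_iff` (`= 1 ⟺ N ≤ M`: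
   THE OBJECT IS FIXED BY `Aut(ℂ/M)` IFF ITS FIELD OF DEFINITION LIES IN `M`), `natCard_range_fixing_dvd`.
§2 CM types (`F` CM, `Φ`, `φ₀`): **`natCard_cmTypeSmul_fixing_eq_relfinrank`** (`#{τΦ ∣ τ ∈ Aut(ℂ/M)} = [M·K* : M]`),
   **`natCard_cmTypeSmul_fixing_fieldRange_eq`** (over `M = φ₀(F)`: `= [E : φ₀(F)]`, `E = E_Φ·φ₀(F)`),
   `natCard_cmTypeSmul_fixing_fieldRange_eq_one_iff` (`= 1 ⟺ E_Φ ⊆ φ₀(F) ⟺ E = φ₀(F)` — RSZ's «possibly proper»),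
   **`natCard_smul_fixing_traceField_eq`** (`#{τφ₀ ∣ τ ∈ Aut(ℂ/E_Φ)} = [E : E_Φ]`), `natCard_datum_fixing_eq_relfinrank`
   (`#{(τΦ, τφ₀) ∣ τ ∈ Aut(ℂ/M)} = [M·E : M]`).
§3 Kottwitz signatures `r : Hom(F, ℂ) → ℕ` (any number field `F`): **`natCard_signature_fixing_eq_relfinrank`**
   (`#{τ·r ∣ τ ∈ Aut(ℂ/M)} = [M·E_r : M]`), `natCard_signature_fixing_eq_one_iff` (`= 1 ⟺ E_r ⊆ M`).

## References

* [MilneFT2022] J. S. Milne, *Fields and Galois Theory* (2022), Prop. 1.20, Prop. 2.7, Cor. 3.4, Thm. 3.16.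
* [Lang2002] S. Lang, *Algebra*, 3rd ed. (2002), Ch. VIII §1.
* [Shimura1998] G. Shimura, *Abelian Varieties with Complex Multiplication and Modular Functions* (1998), §8.3 Prop. 28.
* [Dodson1984] B. Dodson, *The structure of Galois groups of CM-fields*, Trans. AMS 283 (1984), §1.1 Remark (p. 5).
* [RapoportSmithlingZhang2017] M. Rapoport, B. Smithling, W. Zhang, arXiv:1710.06962v3 §3.1 eq. (3.1) and the sentence after it.
* [Kottwitz1992] R. E. Kottwitz, JAMS 5 (1992), §5 pp. 389–390.

## Provenance

Lane `lit-hodgefound` (HOME `run/shared/lean/pub/lit-hodgefound/`), prover seat `lit-hodgefound-p11` (gen 29), self-proposed row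
g29-#10 (lane INBOX claim 2026-08-27), sequel of g29-#5 / g29-#8 / g28-#1.
-/

set_option autoImplicit false

noncomputable section

open scoped Classical
open NumberField Module IntermediateField

namespace Literature.NumberTheory.ComplexMultiplication

open Literature.AlgebraicGeometry.Motives (CMType)
open Literature.AlgebraicGeometry.Motives.HodgeStructure (cmTypeSmul)

/-! ## §0 Preliminaries -/

section Prelim

/-- A number field inside `ℂ` is countable. [folklore] -/
private theorem countable_of_finiteDimensional_go (M : IntermediateField ℚ ℂ) [FiniteDimensional ℚ M] : Countable M :=
  Countable.of_equiv _ (Module.finBasis ℚ M).equivFun.toEquiv.symm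

/-- The image of an embedding of a number field is finite over `ℚ`. [folklore] -/
private theorem finiteDimensional_fieldRange_go {F : Type} [Field F] [NumberField F] (s : F →+* ℂ) :
    FiniteDimensional ℚ s.toRatAlgHom.fieldRange :=
  LinearEquiv.finiteDimensional (AlgEquiv.ofInjectiveField s.toRatAlgHom).toLinearEquiv

/-- `K* = ℚ(tr_Φ)` is finite over `ℚ`. [folklore] -/
private theorem finiteDimensional_traceField_go {F : Type} [Field F] [NumberField F] (Φ : CMType F) :
    FiniteDimensional ℚ (traceField Φ) :=
  Module.finite_of_finrank_pos (finrank_traceField_pos Φ)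

/-- `[M·N : M] > 0` for number fields `M, N ⊂ ℂ`. [folklore] -/
private theorem relfinrank_sup_pos_go (M N : IntermediateField ℚ ℂ) [FiniteDimensional ℚ M] [FiniteDimensional ℚ N] :
    0 < IntermediateField.relfinrank M (M ⊔ N) := by
  haveI : FiniteDimensional ℚ (M ⊔ N : IntermediateField ℚ ℂ) := IntermediateField.finiteDimensional_sup M N
  have h := IntermediateField.finrank_bot_mul_relfinrank (le_sup_left : M ≤ M ⊔ N)
  refine Nat.pos_of_ne_zero fun h0 => ?_
  rw [h0, mul_zero] at h
  exact (Module.finrank_pos (R := ℚ) (M := (M ⊔ N : IntermediateField ℚ ℂ))).ne' h.symm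

end Prelim

/-! ## §1 `#{x τ ∣ τ ∈ Aut(ℂ/M)} = [M·N : M]` -/

section Relative

variable {X : Type} (x : (ℂ ≃+* ℂ) → X) (M N : IntermediateField ℚ ℂ) [FiniteDimensional ℚ M] [FiniteDimensional ℚ N]

/-- **RELATIVE CONJUGATE COUNT: `#{x τ ∣ τ ∈ Aut(ℂ/M)} = [M·N : M]`** — if the objects `x τ` satisfy
`x τ = x τ′ ⟺ τ|_N = τ′|_N` (field of definition `N`), the orbit of `x(id)` under `Aut(ℂ/M)` corresponds bijectively to the
`M`-embeddings `M·N → ℂ` (restriction; every such embedding of the countable field `M·N` extends to `Aut(ℂ/M)`), of which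
there are `[M·N : M]`. [cite: MilneFT2022, Prop. 2.7 and Cor. 3.4] [cite: Lang2002, Ch. VIII §1] -/
theorem natCard_range_fixing_eq_relfinrank (hx : ∀ τ τ' : ℂ ≃+* ℂ, x τ = x τ' ↔ ∀ z : ℂ, z ∈ N → τ z = τ' z) :
    Nat.card {y : X // ∃ τ : ℂ ≃+* ℂ, (∀ z : ℂ, z ∈ M → τ z = z) ∧ y = x τ} =
      IntermediateField.relfinrank M (M ⊔ N) := by
  haveI : FiniteDimensional ℚ (M ⊔ N : IntermediateField ℚ ℂ) := IntermediateField.finiteDimensional_sup M N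
  -- `M·N` as an extension of `M`
  let E : IntermediateField M ℂ := IntermediateField.extendScalars (le_sup_left : M ≤ M ⊔ N)
  have hrel : finrank M E = IntermediateField.relfinrank M (M ⊔ N) :=
    (IntermediateField.relfinrank_eq_finrank_of_le (le_sup_left : M ≤ M ⊔ N)).symm
  haveI : FiniteDimensional M E := Module.finite_of_finrank_pos (by rw [hrel]; exact relfinrank_sup_pos_go M N)
  haveI : Countable E := countable_of_finiteDimensional_go (M ⊔ N)
  -- agreement on `M` and `N` is agreement on `M·N`
  have hagree : ∀ τ τ' : ℂ ≃+* ℂ, (∀ z : ℂ, z ∈ M → τ z = τ' z) → (∀ z : ℂ, z ∈ N → τ z = τ' z) →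
      ∀ z : ℂ, z ∈ M ⊔ N → τ z = τ' z := by
    intro τ τ' hM hN
    have h3 : ∀ S : IntermediateField ℚ ℂ, (∀ z : ℂ, z ∈ S → τ z = τ' z) ↔ ∀ z : ℂ, z ∈ S → (τ'⁻¹ * τ) z = z :=
      fun S => by
        refine forall_congr' fun z => forall_congr' fun _ => ?_
        change τ z = τ' z ↔ τ'.symm (τ z) = z
        rw [RingEquiv.symm_apply_eq]
    rw [h3] at hM hN ⊢
    exact (forall_mem_sup_iff _ M N).2 ⟨hM, hN⟩
  -- the restriction to `M·N` of an automorphism fixing `M`, as an `M`-algebra map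
  let res : ∀ τ : ℂ ≃+* ℂ, (∀ z : ℂ, z ∈ M → τ z = z) → (E →ₐ[M] ℂ) := fun τ hτ =>
    { toRingHom := (τ : ℂ →+* ℂ).comp (algebraMap E ℂ)
      commutes' := fun m => hτ m m.2 }
  have hres : ∀ (τ : ℂ ≃+* ℂ) (hτ : ∀ z : ℂ, z ∈ M → τ z = z) (z : E), res τ hτ z = τ z := fun _ _ _ => rfl
  let f : {y : X // ∃ τ : ℂ ≃+* ℂ, (∀ z : ℂ, z ∈ M → τ z = z) ∧ y = x τ} → (E →ₐ[M] ℂ) :=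
    fun y => res y.2.choose y.2.choose_spec.1
  have hf : ∀ (τ : ℂ ≃+* ℂ) (hτ : ∀ z : ℂ, z ∈ M → τ z = z),
      f ⟨x τ, τ, hτ, rfl⟩ = res τ hτ := fun τ hτ => by
    have hc := (⟨x τ, τ, hτ, rfl⟩ : {y : X // ∃ τ : ℂ ≃+* ℂ, (∀ z : ℂ, z ∈ M → τ z = z) ∧ y = x τ}).2.choose_spec
    refine AlgHom.ext fun z => ?_
    rw [hres, hres]
    exact hagree _ _ (fun w hw => by rw [hc.1 w hw, hτ w hw]) ((hx _ _).1 hc.2.symm) z z.2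
  have hbij : Function.Bijective f := by
    constructor
    · rintro ⟨y, τ, hτ, rfl⟩ ⟨y', τ', hτ', rfl⟩ hyy
      rw [hf τ hτ, hf τ' hτ'] at hyy
      refine Subtype.ext ((hx τ τ').2 fun z hz => ?_)
      have h1 := DFunLike.congr_fun hyy ⟨z, (le_sup_right : N ≤ M ⊔ N) hz⟩
      rwa [hres, hres] at h1
    · intro ψ
      obtain ⟨τ, hτ⟩ := Literature.AlgebraicGeometry.Motives.ZarhinLie.exists_ringEquiv_complex_comp_eq
        (algebraMap E ℂ) ψ.toRingHom
      have hfix : ∀ z : ℂ, z ∈ M → τ z = z := fun z hz => by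
        have h1 := hτ ⟨z, (le_sup_left : M ≤ M ⊔ N) hz⟩
        have h2 := ψ.commutes ⟨z, hz⟩
        exact h1.trans h2
      refine ⟨⟨x τ, τ, hfix, rfl⟩, ?_⟩
      rw [hf τ hfix]
      exact AlgHom.ext fun z => hτ z
  rw [Nat.card_eq_of_bijective f hbij, Nat.card_eq_fintype_card, AlgHom.card, hrel]

/-- `#{x τ ∣ τ ∈ Aut(ℂ/M)} · [M : ℚ] = [M·N : ℚ]` (tower law). [cite: MilneFT2022, Prop. 1.20 and Prop. 2.7] -/
theorem natCard_range_fixing_mul_finrank (hx : ∀ τ τ' : ℂ ≃+* ℂ, x τ = x τ' ↔ ∀ z : ℂ, z ∈ N → τ z = τ' z) :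
    Nat.card {y : X // ∃ τ : ℂ ≃+* ℂ, (∀ z : ℂ, z ∈ M → τ z = z) ∧ y = x τ} * finrank ℚ M =
      finrank ℚ (M ⊔ N : IntermediateField ℚ ℂ) := by
  rw [natCard_range_fixing_eq_relfinrank x M N hx, mul_comm]
  exact IntermediateField.finrank_bot_mul_relfinrank (le_sup_left : M ≤ M ⊔ N)

/-- `M ≤ N`: `#{x τ ∣ τ ∈ Aut(ℂ/M)} = [N : M]`. [cite: MilneFT2022, Prop. 2.7 and Cor. 3.4] -/
theorem natCard_range_fixing_eq_relfinrank_of_le (hx : ∀ τ τ' : ℂ ≃+* ℂ, x τ = x τ' ↔ ∀ z : ℂ, z ∈ N → τ z = τ' z)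
    (h : M ≤ N) :
    Nat.card {y : X // ∃ τ : ℂ ≃+* ℂ, (∀ z : ℂ, z ∈ M → τ z = z) ∧ y = x τ} = IntermediateField.relfinrank M N := by
  rw [natCard_range_fixing_eq_relfinrank x M N hx, sup_eq_right.2 h]

/-- **`#{x τ ∣ τ ∈ Aut(ℂ/M)} = 1 ⟺ N ≤ M`**: the object is fixed by all of `Aut(ℂ/M)` iff its field of definition lies in `M`.
[cite: MilneFT2022, Cor. 3.4 and Thm. 3.16] -/
theorem natCard_range_fixing_eq_one_iff (hx : ∀ τ τ' : ℂ ≃+* ℂ, x τ = x τ' ↔ ∀ z : ℂ, z ∈ N → τ z = τ' z) :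
    Nat.card {y : X // ∃ τ : ℂ ≃+* ℂ, (∀ z : ℂ, z ∈ M → τ z = z) ∧ y = x τ} = 1 ↔ N ≤ M := by
  rw [natCard_range_fixing_eq_relfinrank x M N hx, IntermediateField.relfinrank_eq_one_iff, sup_le_iff]
  exact ⟨fun h => h.2, fun h => ⟨le_rfl, h⟩⟩

/-- `#{x τ ∣ τ ∈ Aut(ℂ/M)} ∣ [M·N : ℚ]`. [cite: MilneFT2022, Prop. 1.20] -/
theorem natCard_range_fixing_dvd (hx : ∀ τ τ' : ℂ ≃+* ℂ, x τ = x τ' ↔ ∀ z : ℂ, z ∈ N → τ z = τ' z) :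
    Nat.card {y : X // ∃ τ : ℂ ≃+* ℂ, (∀ z : ℂ, z ∈ M → τ z = z) ∧ y = x τ} ∣
      finrank ℚ (M ⊔ N : IntermediateField ℚ ℂ) :=
  Dvd.intro _ (natCard_range_fixing_mul_finrank x M N hx)

end Relative

/-! ## §2 CM types, the distinguished element and the Rapoport–Smithling–Zhang datum over a subfield -/

section CMTypes

variable {F : Type} [Field F] [NumberField F] (Φ : CMType F) (φ₀ : F →+* ℂ) (M : IntermediateField ℚ ℂ) [FiniteDimensional ℚ M]

/-- `τφ₀ = τ′φ₀ ⟺ τ|_{φ₀(F)} = τ′|_{φ₀(F)}`. [folklore] -/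
private theorem smul_eq_smul_iff_go (τ τ' : ℂ ≃+* ℂ) :
    τ • φ₀ = τ' • φ₀ ↔ ∀ z : ℂ, z ∈ φ₀.toRatAlgHom.fieldRange → τ z = τ' z := by
  constructor
  · intro h z hz
    obtain ⟨a, rfl⟩ := AlgHom.mem_fieldRange.1 hz
    have ha := RingHom.congr_fun h a
    rw [ringEquiv_smul_apply, ringEquiv_smul_apply] at ha
    exact ha
  · intro h
    exact RingHom.ext fun a => by
      rw [ringEquiv_smul_apply, ringEquiv_smul_apply]
      exact h _ (AlgHom.mem_fieldRange.2 ⟨a, rfl⟩)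

/-- `#{τφ₀ ∣ τ ∈ Aut(ℂ/M)} = [M·φ₀(F) : M]` for any number field `M ⊂ ℂ`. [cite: MilneFT2022, Prop. 2.7 and Cor. 3.4] -/
theorem natCard_smul_fixing_eq_relfinrank :
    Nat.card {ψ : F →+* ℂ // ∃ τ : ℂ ≃+* ℂ, (∀ z : ℂ, z ∈ M → τ z = z) ∧ ψ = τ • φ₀} =
      IntermediateField.relfinrank M (M ⊔ φ₀.toRatAlgHom.fieldRange) := by
  haveI := finiteDimensional_fieldRange_go φ₀
  exact natCard_range_fixing_eq_relfinrank (fun τ : ℂ ≃+* ℂ => τ • φ₀) M φ₀.toRatAlgHom.fieldRange (smul_eq_smul_iff_go φ₀)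

/-- **`#{τφ₀ ∣ τ ∈ Aut(ℂ/E_Φ)} = [E : E_Φ]`**: the conjugates of the distinguished embedding by automorphisms fixing the reflex
field of `Φ` number the relative degree of `E = E_Φ·φ₀(F)` over `E_Φ` («Manifestly `E_Φ ⊂ E`»).
[cite: RapoportSmithlingZhang2017, §3.1 Remark 3.1 (i)] [cite: MilneFT2022, Prop. 2.7] -/
theorem natCard_smul_fixing_traceField_eq :
    Nat.card {ψ : F →+* ℂ // ∃ τ : ℂ ≃+* ℂ, (∀ z : ℂ, z ∈ traceField Φ → τ z = z) ∧ ψ = τ • φ₀} =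
      IntermediateField.relfinrank (traceField Φ) (traceField Φ ⊔ φ₀.toRatAlgHom.fieldRange) := by
  haveI := finiteDimensional_traceField_go Φ
  haveI := finiteDimensional_fieldRange_go φ₀
  exact natCard_range_fixing_eq_relfinrank (fun τ : ℂ ≃+* ℂ => τ • φ₀) (traceField Φ) φ₀.toRatAlgHom.fieldRange
    (smul_eq_smul_iff_go φ₀)

variable [IsCMField F]

/-- **`#{τΦ ∣ τ ∈ Aut(ℂ/M)} = [M·K* : M]`**: the conjugates of a CM type over a number field `M ⊂ ℂ` (Shimura's Prop. 28
relative to `M`: `τΦ = τ′Φ ⟺ τ|_{K*} = τ′|_{K*}`). [cite: Shimura1998, §8.3 Prop. 28] [cite: Dodson1984, §1.1 Remark (p. 5)]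
[cite: MilneFT2022, Prop. 2.7] -/
theorem natCard_cmTypeSmul_fixing_eq_relfinrank :
    Nat.card {Ψ : CMType F // ∃ τ : ℂ ≃+* ℂ, (∀ z : ℂ, z ∈ M → τ z = z) ∧ Ψ = cmTypeSmul τ Φ} =
      IntermediateField.relfinrank M (M ⊔ traceField Φ) := by
  haveI := finiteDimensional_traceField_go Φ
  exact natCard_range_fixing_eq_relfinrank (fun τ : ℂ ≃+* ℂ => cmTypeSmul τ Φ) M (traceField Φ)
    (fun τ τ' => cmTypeSmul_eq_cmTypeSmul_iff τ τ' Φ)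

/-- **Over `M = φ₀(F)`: `#{τΦ ∣ τ ∈ Aut(ℂ/φ₀(F))} = [E : φ₀(F)]`, `E = E_Φ · φ₀(F)`** (the conjugates of `Φ` by automorphisms
fixing `F` embedded via `φ₀`). [cite: RapoportSmithlingZhang2017, §3.1 eq. (3.1) and the sentence after it]
[cite: Shimura1998, §8.3 Prop. 28] -/
theorem natCard_cmTypeSmul_fixing_fieldRange_eq :
    Nat.card {Ψ : CMType F // ∃ τ : ℂ ≃+* ℂ, (∀ z : ℂ, z ∈ φ₀.toRatAlgHom.fieldRange → τ z = z) ∧ Ψ = cmTypeSmul τ Φ} =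
      IntermediateField.relfinrank φ₀.toRatAlgHom.fieldRange (traceField Φ ⊔ φ₀.toRatAlgHom.fieldRange) := by
  haveI := finiteDimensional_fieldRange_go φ₀
  rw [natCard_cmTypeSmul_fixing_eq_relfinrank, sup_comm]

/-- **`#{τΦ ∣ τ ∈ Aut(ℂ/φ₀(F))} = 1 ⟺ E_Φ ⊆ φ₀(F)`** (⟺ `E = φ₀(F)`; RSZ: «possibly a proper extension when `F/ℚ` is not
Galois» — it is proper exactly when some automorphism fixing `φ₀(F)` moves `Φ`). [cite: RapoportSmithlingZhang2017, §3.1 (after eq. (3.1))]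
[cite: MilneFT2022, Cor. 3.4] -/
theorem natCard_cmTypeSmul_fixing_fieldRange_eq_one_iff :
    Nat.card {Ψ : CMType F // ∃ τ : ℂ ≃+* ℂ, (∀ z : ℂ, z ∈ φ₀.toRatAlgHom.fieldRange → τ z = z) ∧ Ψ = cmTypeSmul τ Φ} = 1 ↔
      traceField Φ ≤ φ₀.toRatAlgHom.fieldRange := by
  haveI := finiteDimensional_traceField_go Φ
  haveI := finiteDimensional_fieldRange_go φ₀
  exact natCard_range_fixing_eq_one_iff (fun τ : ℂ ≃+* ℂ => cmTypeSmul τ Φ) φ₀.toRatAlgHom.fieldRange (traceField Φ)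
    (fun τ τ' => cmTypeSmul_eq_cmTypeSmul_iff τ τ' Φ)

/-- **`#{(τΦ, τφ₀) ∣ τ ∈ Aut(ℂ/M)} = [M·E : M]`**, `E = E_Φ·φ₀(F)` the reflex field of the datum (g29-#5
`cmTypeSmul_eq_and_smul_eq_iff`). [cite: RapoportSmithlingZhang2017, §3.1 eq. (3.1)] [cite: MilneFT2022, Prop. 2.7] -/
theorem natCard_datum_fixing_eq_relfinrank :
    Nat.card {p : CMType F × (F →+* ℂ) // ∃ τ : ℂ ≃+* ℂ, (∀ z : ℂ, z ∈ M → τ z = z) ∧ p = (cmTypeSmul τ Φ, τ • φ₀)} =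
      IntermediateField.relfinrank M (M ⊔ (traceField Φ ⊔ φ₀.toRatAlgHom.fieldRange)) := by
  haveI := finiteDimensional_traceField_go Φ
  haveI := finiteDimensional_fieldRange_go φ₀
  haveI : FiniteDimensional ℚ (traceField Φ ⊔ φ₀.toRatAlgHom.fieldRange : IntermediateField ℚ ℂ) :=
    IntermediateField.finiteDimensional_sup _ _
  refine natCard_range_fixing_eq_relfinrank (fun τ : ℂ ≃+* ℂ => (cmTypeSmul τ Φ, τ • φ₀)) M _ fun τ τ' => ?_
  rw [Prod.mk.injEq]
  exact cmTypeSmul_eq_and_smul_eq_iff Φ φ₀ τ τ'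

/-- Over `E_Φ`: `#{(τΦ, τφ₀) ∣ τ ∈ Aut(ℂ/E_Φ)} = [E : E_Φ]` (there `τΦ = Φ`, so this is again the count of the `τφ₀`).
[cite: RapoportSmithlingZhang2017, §3.1 Remark 3.1 (i)] -/
theorem natCard_datum_fixing_traceField_eq :
    Nat.card {p : CMType F × (F →+* ℂ) // ∃ τ : ℂ ≃+* ℂ, (∀ z : ℂ, z ∈ traceField Φ → τ z = z) ∧ p = (cmTypeSmul τ Φ, τ • φ₀)} =
      IntermediateField.relfinrank (traceField Φ) (traceField Φ ⊔ φ₀.toRatAlgHom.fieldRange) := by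
  haveI := finiteDimensional_traceField_go Φ
  rw [natCard_datum_fixing_eq_relfinrank, ← sup_assoc, sup_idem]

end CMTypes

/-! ## §3 Kottwitz signatures over a subfield -/

section Signature

variable {F : Type} [Field F] [NumberField F] (r : (F →+* ℂ) → ℕ) (M : IntermediateField ℚ ℂ) [FiniteDimensional ℚ M]

/-- **`#{τ·r ∣ τ ∈ Aut(ℂ/M)} = [M·E_r : M]`** (`τ·r := r ∘ τ⁻¹`; g29-#5 `smul_signature_eq_smul_signature_iff`).
[cite: Kottwitz1992, §5 pp. 389–390] [cite: MilneFT2022, Prop. 2.7 and Cor. 3.4] -/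
theorem natCard_signature_fixing_eq_relfinrank :
    Nat.card {r' : (F →+* ℂ) → ℕ // ∃ τ : ℂ ≃+* ℂ, (∀ z : ℂ, z ∈ M → τ z = z) ∧ r' = fun φ => r (τ⁻¹ • φ)} =
      IntermediateField.relfinrank M
        (M ⊔ IntermediateField.adjoin ℚ (Set.range fun a : F => ∑ φ : F →+* ℂ, (r φ : ℂ) * φ a)) := by
  haveI := finiteDimensional_adjoin_sum r
  exact natCard_range_fixing_eq_relfinrank (fun τ : ℂ ≃+* ℂ => fun φ : F →+* ℂ => r (τ⁻¹ • φ)) M _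
    (smul_signature_eq_smul_signature_iff r)

/-- **`τ·r = r` for every `τ ∈ Aut(ℂ/M)` ⟺ `E_r ⊆ M`** (the class of `V₁` is defined over `M` iff `M` contains the reflex
field). [cite: Kottwitz1992, §5 pp. 389–390] [cite: MilneFT2022, Cor. 3.4] -/
theorem natCard_signature_fixing_eq_one_iff :
    Nat.card {r' : (F →+* ℂ) → ℕ // ∃ τ : ℂ ≃+* ℂ, (∀ z : ℂ, z ∈ M → τ z = z) ∧ r' = fun φ => r (τ⁻¹ • φ)} = 1 ↔
      IntermediateField.adjoin ℚ (Set.range fun a : F => ∑ φ : F →+* ℂ, (r φ : ℂ) * φ a) ≤ M := by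
  haveI := finiteDimensional_adjoin_sum r
  exact natCard_range_fixing_eq_one_iff (fun τ : ℂ ≃+* ℂ => fun φ : F →+* ℂ => r (τ⁻¹ • φ)) M _
    (smul_signature_eq_smul_signature_iff r)

end Signature

end Literature.NumberTheory.ComplexMultiplication
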